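import Literature.Analysis.FluidPDE.NSBoundedSuitableCauchy
import Literature.Analysis.FluidPDE.LocalTypeILscGradientTools
import HarnessLib

/-!
# Bounded distributional Navier–Stokes solutions are suitable weak solutions

Analysis/FluidPDE proof file (theorem-only) completing the discharge of
`Literature.Analysis.FluidPDE.SereginSverak2009.SuitableOfBounded` (Seregin–Šverák 2009,
Remark 3.4) begun in `NSBoundedSuitablePrelim` and `NSBoundedSuitableCauchy`. Let `(u, p)` be a
distributional solution of the unforced Navier–Stokes system (viscosity `ν > 0`) on an open
`Ω ⊆ ℝ × E` of finite measure with `u` essentially bounded on `Ω` and `p ∈ L^{3/2}(Ω)`, and let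
`K ⊆ Ω` be compact, `Ω' ⊆ K` open. With the `L²` limit `G̃` of the truncated mollified gradients
`𝟙_K D(kₙ ⋆ 𝟙_Ω u)` (`exists_L2_limit_mollifiedGradient`):

* `hasWeakSpatialGradientOn_of_L2_limit` — `G̃` is a weak spatial gradient of `u` on `Ω'`
  (integrate by parts against the smooth mollifications and pass to the limit);
* `localEnergyInequality_of_L2_limit` — the local energy inequality (indeed equality) of
  Caffarelli–Kohn–Nirenberg 1982, (2.5), for every nonnegative test function on `Ω'`: the
  smooth local energy identity for the mollified system (`local_energy_identity_smooth`) passes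
  to the limit term by term, the transport term through the identity
  `2 ∫ φ ⟪DV(V), V⟫ = -∫ |V|² ⟪V, ∇φ⟫` for the divergence-free mollified velocity and the
  `L²`-vanishing of the commutator `kₙ ⋆ (uᵢu) - (kₙ ⋆ u)ᵢ (kₙ ⋆ u)` (here through `u ∈ L⁴(Ω)`);
* `isSuitableWeakSolutionOn_of_bounded_of_subset` and `isSuitableWeakSolutionOn_of_bounded` —
  **bounded distributional solutions are suitable weak solutions** (CKN 1982, §2; Serrin 1962),
  first on relatively compact `Ω' ⊆ Ω`, then on `Ω` by exhaustion
  (`IsSuitableWeakSolutionOn.of_exhaustion`).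

This is the content of "it is certainly true in `B × ]-1,-a²[`" (Seregin–Šverák 2009, §2,
p. 6 of arXiv:0804.1803) behind Remark 3.4 there; the Seregin–Šverák statement itself is
assembled in `SereginSverakAxisymmetricProofs`.

## References

* G. Seregin, V. Šverák, Comm. PDE 34 (2009), arXiv:0804.1803, §2 p. 6 and Remark 3.4.
* L. Caffarelli, R. Kohn, L. Nirenberg, CPAM 35 (1982), §2, (2.1)–(2.5).
* J. Serrin, Arch. Rational Mech. Anal. 9 (1962), §2.
-/

noncomputable section

open MeasureTheory TopologicalSpace Set Function Filter Topology ContinuousLinearMap Metric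
  InnerProductSpace Module
open scoped ENNReal NNReal Convolution RealInnerProductSpace Laplacian

namespace Literature.Analysis.FluidPDE

section Limits

variable {E : Type*} [NormedAddCommGroup E] [InnerProductSpace ℝ E] [FiniteDimensional ℝ E]
  [MeasurableSpace E] [BorelSpace E]

/-- **Smooth integration by parts, scalar form**: for `V ∈ C¹(E; E)` and a smooth compactly
supported `φ`, `∫ ∂ᵥφ ⟪V, w⟫ = -∫ φ ⟪DV v, w⟫` (the defining identity of weak gradients,
satisfied by classical ones; Evans, *PDE*, §5.2.1). [folklore] -/
theorem integral_fderiv_mul_inner_eq_of_contDiff {V : E → E} (hV : ContDiff ℝ 1 V) {φ : E → ℝ}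
    (hφ : ContDiff ℝ (⊤ : ℕ∞) φ) (hφc : HasCompactSupport φ) (v w : E) :
    ∫ x, fderiv ℝ φ x v * ⟪V x, w⟫ = -∫ x, φ x * ⟪fderiv ℝ V x v, w⟫ := by
  have hW := hasWeakGradient_fderiv_of_contDiff hV
  have key := hW.integral_fderiv_smul_eq φ v ⟨hφ, hφc, fun _ _ => trivial⟩
  simp only [Opens.coe_top, Measure.restrict_univ] at key
  have h1 : Integrable (fun x => fderiv ℝ φ x v • V x) :=
    ((hφ.continuous_fderiv (by simp)).clm_apply continuous_const).smul hV.continuous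
      |>.integrable_of_hasCompactSupport ((hφc.fderiv_apply (𝕜 := ℝ) v).smul_right)
  have h2 : Integrable (fun x => φ x • fderiv ℝ V x v) :=
    (hφ.continuous.smul ((hV.continuous_fderiv one_ne_zero).clm_apply continuous_const))
      |>.integrable_of_hasCompactSupport (hφc.smul_right)
  calc ∫ x, fderiv ℝ φ x v * ⟪V x, w⟫ = ∫ x, ⟪w, fderiv ℝ φ x v • V x⟫ := by
        refine integral_congr_ae (Eventually.of_forall fun x => ?_)
        dsimp only
        rw [real_inner_smul_right, real_inner_comm (V x) w]
    _ = ⟪w, ∫ x, fderiv ℝ φ x v • V x⟫ := integral_inner h1 w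
    _ = ⟪w, -∫ x, φ x • fderiv ℝ V x v⟫ := by rw [key]
    _ = -∫ x, φ x * ⟪fderiv ℝ V x v, w⟫ := by
        rw [inner_neg_right, ← integral_inner h2 w]
        congr 1
        refine integral_congr_ae (Eventually.of_forall fun x => ?_)
        dsimp only
        rw [real_inner_smul_right, real_inner_comm (fderiv ℝ V x v) w]

/-- **`L²` limits pass through pairings with continuous compactly supported weight fields**:
if `Aₙ → A` in `L²(ℝ × E; E)` (all in `L²`) and `W` is a continuous compactly supported field,
then `∫ ⟪Aₙ, W⟫ → ∫ ⟪A, W⟫`. [folklore] -/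
theorem tendsto_integral_inner_of_tendsto_eLpNorm_two {A : ℕ → ℝ × E → E} {A₀ : ℝ × E → E}
    (hA : ∀ n, MemLp (A n) 2 volume) (hA₀ : MemLp A₀ 2 volume)
    (hconv : Tendsto (fun n => eLpNorm (A n - A₀) 2 volume) atTop (𝓝 0))
    {W : ℝ × E → E} (hW : Continuous W) (hWc : HasCompactSupport W) :
    Tendsto (fun n => ∫ z, ⟪A n z, W z⟫) atTop (𝓝 (∫ z, ⟪A₀ z, W z⟫)) := by
  haveI : (volume : Measure (ℝ × E)).IsAddHaarMeasure := Measure.prod.instIsAddHaarMeasure _ _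
  haveI : ENNReal.HolderTriple 2 2 1 := ENNReal.HolderConjugate.instTwoTwo
  have mW : MemLp W 2 (volume : Measure (ℝ × E)) := hW.memLp_of_hasCompactSupport hWc
  have cW : Tendsto (fun _ : ℕ => eLpNorm (W - W) 2 (volume : Measure (ℝ × E))) atTop (𝓝 0) := by
    simp
  have h := tendsto_setIntegral_mul_bilin (p := 2) (q := 2) one_le_two (innerSL ℝ) hA hA₀
    (fun _ => mW) mW hconv cW (w := fun _ => (1 : ℝ)) (C := 1)
    aestronglyMeasurable_const (Eventually.of_forall fun _ => by simp) univ
  simp only [Measure.restrict_univ, one_mul] at h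
  exact h

/-- **`L²` limits of operator fields pass through weighted matrix coefficients**: if `Fₙ → G`
in `L²(ℝ × E; E →L E)` and `θ` is a continuous compactly supported weight, then
`∫ θ ⟪Fₙ v, w⟫ → ∫ θ ⟪G v, w⟫`. [folklore] -/
theorem tendsto_integral_mul_inner_apply_of_tendsto_eLpNorm_two {F : ℕ → ℝ × E → E →L[ℝ] E}
    {G : ℝ × E → E →L[ℝ] E} (hF : ∀ n, MemLp (F n) 2 volume) (hG : MemLp G 2 volume)
    (hconv : Tendsto (fun n => eLpNorm (F n - G) 2 volume) atTop (𝓝 0))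
    {θ : ℝ × E → ℝ} (hθ : Continuous θ) (hθc : HasCompactSupport θ) (v w : E) :
    Tendsto (fun n => ∫ z, θ z * ⟪F n z v, w⟫) atTop (𝓝 (∫ z, θ z * ⟪G z v, w⟫)) := by
  haveI : (volume : Measure (ℝ × E)).IsAddHaarMeasure := Measure.prod.instIsAddHaarMeasure _ _
  haveI : ENNReal.HolderTriple 2 2 1 := ENNReal.HolderConjugate.instTwoTwo
  -- the bilinear form `β L c = c * ⟪L v, w⟫`
  set ℓ : (E →L[ℝ] E) →L[ℝ] ℝ := (innerSL ℝ w).comp (ContinuousLinearMap.apply ℝ E v) with hℓ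
  set β : (E →L[ℝ] E) →L[ℝ] ℝ →L[ℝ] ℝ := (ContinuousLinearMap.mul ℝ ℝ).comp ℓ with hβ
  have β_apply : ∀ (L : E →L[ℝ] E) (c : ℝ), β L c = ⟪L v, w⟫ * c := fun L c => by
    simp [hβ, hℓ, real_inner_comm]
  have mθ : MemLp θ 2 (volume : Measure (ℝ × E)) := hθ.memLp_of_hasCompactSupport hθc
  have cθ : Tendsto (fun _ : ℕ => eLpNorm (θ - θ) 2 (volume : Measure (ℝ × E))) atTop (𝓝 0) := by
    simp
  have h := tendsto_setIntegral_mul_bilin (p := 2) (q := 2) one_le_two β hF hG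
    (fun _ => mθ) mθ hconv cθ (w := fun _ => (1 : ℝ)) (C := 1)
    aestronglyMeasurable_const (Eventually.of_forall fun _ => by simp) univ
  simp only [Measure.restrict_univ, one_mul, β_apply] at h
  have e : ∀ (H : ℝ × E → E →L[ℝ] E), (fun z => ⟪H z v, w⟫ * θ z) = fun z => θ z * ⟪H z v, w⟫ :=
    fun H => funext fun z => mul_comm _ _
  simp only [e] at h
  exact h

end Limits

/-! ### The `L²` limit of the mollified gradients is the weak spatial gradient -/

section Gradient

variable {E : Type*} [NormedAddCommGroup E] [InnerProductSpace ℝ E] [FiniteDimensional ℝ E]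
  [MeasurableSpace E] [BorelSpace E]

set_option maxHeartbeats 800000 in
/-- **The `L²` limit of the truncated mollified gradients is a weak spatial gradient.** In the
setting of `exists_L2_limit_mollifiedGradient` (`u` integrable and square integrable on the
open `Ω`, kernels `kₙ` with radii `→ 0`, `K ⊆ Ω` compact, `𝟙_K D(kₙ ⋆ 𝟙_Ω u) → G̃` in `L²`),
`G̃` is a weak spatial gradient of `u` on every open `Ω' ⊆ K` (accepted
`HasWeakSpatialGradientOn`; CKN 1982, (2.1)): the mollifications satisfy the integration by
parts identity classically, `kₙ ⋆ 𝟙_Ω u → 𝟙_Ω u` in `L²`, and both sides pass to the limit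
(Evans, *PDE*, §5.2.1). [cite: CaffarelliKohnNirenberg1982, (2.1)] -/
theorem hasWeakSpatialGradientOn_of_L2_limit
    {Ω : Opens (ℝ × E)} (hΩ : volume (Ω : Set (ℝ × E)) < ∞) {u : ℝ → E → E}
    (hul : LocallyIntegrableOn (uncurry u) (Ω : Set (ℝ × E)) volume)
    (hu2Q : MemLp (uncurry u) 2 (volume.restrict (Ω : Set (ℝ × E))))
    {bump : ℕ → ContDiffBump (0 : ℝ × E)} (hbr : Tendsto (fun n => (bump n).rOut) atTop (𝓝 0))
    {K : Set (ℝ × E)} (hK : IsCompact K) (hKΩ : K ⊆ (Ω : Set (ℝ × E)))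
    {Gt : ℝ × E → E →L[ℝ] E} (hGt : MemLp Gt 2 volume)
    (hconv : Tendsto (fun n => eLpNorm (K.indicator (fun z : ℝ × E =>
        fderiv ℝ (stMollify ((bump n).normed volume) (zeroExt Ω u) z.1) z.2) - Gt) 2 volume)
        atTop (𝓝 0))
    {Ω' : Opens (ℝ × E)} (hΩ'K : (Ω' : Set (ℝ × E)) ⊆ K) :
    HasWeakSpatialGradientOn Ω' u fun t x => Gt (t, x) := by
  haveI : (volume : Measure (ℝ × E)).IsAddHaarMeasure := Measure.prod.instIsAddHaarMeasure _ _
  have hQm : MeasurableSet (Ω : Set (ℝ × E)) := Ω.isOpen.measurableSet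
  haveI : IsFiniteMeasure (volume.restrict (Ω : Set (ℝ × E))) :=
    ⟨by rwa [Measure.restrict_apply_univ]⟩
  have hΩ'Ω : (Ω' : Set (ℝ × E)) ⊆ (Ω : Set (ℝ × E)) := hΩ'K.trans hKΩ
  -- the zero extension and the mollifications
  set ũ : ℝ × E → E := zeroExt Ω u with hũ
  have hũ2 : MemLp ũ 2 volume := memLp_zeroExt rfl hQm hu2Q
  have huI : IntegrableOn (uncurry u) (Ω : Set (ℝ × E)) volume := hu2Q.integrable one_le_two
  have hũi : LocallyIntegrable ũ volume := locallyIntegrable_zeroExt huI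
  set k : ℕ → ℝ × E → ℝ := fun n => (bump n).normed volume with hk
  have hkinf : ∀ n, ContDiff ℝ (⊤ : ℕ∞) (k n) := fun n => (bump n).contDiff_normed
  have hkc : ∀ n, HasCompactSupport (k n) := fun n => (bump n).hasCompactSupport_normed
  set V : ℕ → ℝ → E → E := fun n => stMollify (k n) ũ with hV
  set D : ℕ → ℝ × E → E →L[ℝ] E := fun n z => fderiv ℝ (V n z.1) z.2 with hD
  set F : ℕ → ℝ × E → E →L[ℝ] E := fun n => K.indicator (D n) with hF
  have hVsm : ∀ n, ContDiff ℝ (⊤ : ℕ∞) (uncurry (V n)) := fun n =>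
    contDiff_uncurry_stMollify (hkinf n) (hkc n) hũi
  have hVc : ∀ n, Continuous (uncurry (V n)) := fun n => (hVsm n).continuous
  have hV1 : ∀ n s, ContDiff ℝ 1 (V n s) := fun n s =>
    (contDiff_stMollify_slice (hkinf n) (hkc n) hũi s).of_le one_le_infty
  have hDc : ∀ n, Continuous (D n) := fun n => by
    have sV : IsSmoothSpaceTimeOn univ (V n) := (hVsm n).contDiffOn
    exact (sV.fderiv_slice uniqueDiffOn_univ).continuous_uncurry
  have cV2 : Tendsto (fun n => eLpNorm (uncurry (V n) - ũ) 2 volume) atTop (𝓝 0) :=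
    FunctionSpaces.tendsto_eLpNorm_normed_convolution_sub_self hbr (by norm_num) (by norm_num) hũ2
  have mV2 : ∀ n, MemLp (uncurry (V n)) 2 volume := fun n =>
    UnboundedOperators.memLp_convolution_lsmul (bump n).integrable_normed hũ2 (by norm_num)
  refine ⟨hul.mono_set hΩ'Ω, ?_, fun φ hφ v w => ?_⟩
  · -- local integrability of the gradient
    have h : LocallyIntegrable Gt volume := hGt.locallyIntegrable one_le_two
    exact h.locallyIntegrableOn _
  -- the identity: smooth integration by parts for each `n`
  have hKφ : IsCompact (tsupport (uncurry φ)) := hφ.hasCompactSupport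
  have hKφΩ' : tsupport (uncurry φ) ⊆ (Ω' : Set (ℝ × E)) := hφ.tsupport_subset
  have hIBP : ∀ n, (∫ s, ∫ y, fderiv ℝ (φ s) y v * ⟪V n s y, w⟫) =
      -∫ s, ∫ y, φ s y * ⟪D n (s, y) v, w⟫ := fun n => by
    rw [← integral_neg]
    refine integral_congr_ae (Eventually.of_forall fun s => ?_)
    exact integral_fderiv_mul_inner_eq_of_contDiff (hV1 n s) (hφ.contDiff_slice s)
      (hφ.hasCompactSupport_slice s) v w
  -- the weights
  have hdφ : IsSpaceTimeTestOn ⊤ (fun s y => fderiv ℝ (φ s) y v) :=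
    (hφ.mono le_top).fderiv_apply_top v
  have cdφ : Continuous (uncurry fun s y => fderiv ℝ (φ s) y v) := hdφ.contDiff.continuous
  have cφ : Continuous (uncurry φ) := hφ.contDiff.continuous
  have hd0 : ∀ z : ℝ × E, z ∉ tsupport (uncurry φ) → fderiv ℝ (φ z.1) z.2 v = 0 := by
    rintro ⟨s, y⟩ hz
    simp [IsSpaceTimeTestOn.fderiv_slice_eq_zero_of_notMem hz]
  have hφ0 : ∀ z : ℝ × E, z ∉ tsupport (uncurry φ) → φ z.1 z.2 = 0 := fun z hz =>
    image_eq_zero_of_notMem_tsupport (f := uncurry φ) hz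
  set W : ℝ × E → E := fun z => fderiv ℝ (φ z.1) z.2 v • w with hW
  have cW : Continuous W := cdφ.smul continuous_const
  have sW : HasCompactSupport W := HasCompactSupport.intro hKφ fun z hz => by
    simp only [hW, hd0 z hz, zero_smul]
  set θ : ℝ × E → ℝ := fun z => φ z.1 z.2 with hθ
  have cθ : Continuous θ := cφ
  have sθ : HasCompactSupport θ := hφ.hasCompactSupport
  -- product-integral forms and their limits
  have eL : ∀ n, (∫ s, ∫ y, fderiv ℝ (φ s) y v * ⟪V n s y, w⟫) =
      ∫ z, ⟪uncurry (V n) z, W z⟫ := fun n => by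
    have hint : Integrable (fun z : ℝ × E => ⟪uncurry (V n) z, W z⟫)
        ((volume : Measure ℝ).prod (volume : Measure E)) := by
      rw [← Measure.volume_eq_prod]
      exact ((hVc n).inner cW).integrable_of_hasCompactSupport
        (HasCompactSupport.intro hKφ fun z hz => by simp only [hW, hd0 z hz, zero_smul,
          inner_zero_right])
    rw [Measure.volume_eq_prod, integral_prod _ hint]
    refine integral_congr_ae (Eventually.of_forall fun s => integral_congr_ae
      (Eventually.of_forall fun y => ?_))
    simp only [hW, uncurry, real_inner_smul_right, mul_comm]
  have eF : ∀ n (z : ℝ × E), θ z * ⟪F n z v, w⟫ = φ z.1 z.2 * ⟪D n z v, w⟫ := fun n z => by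
    by_cases hz : z ∈ K
    · simp only [hθ, hF, indicator_of_mem hz]
    · have h0 : φ z.1 z.2 = 0 := hφ0 z fun h => hz (hΩ'K (hKφΩ' h))
      simp only [hθ, h0, zero_mul]
  have eR : ∀ n, (∫ s, ∫ y, φ s y * ⟪D n (s, y) v, w⟫) = ∫ z, θ z * ⟪F n z v, w⟫ := fun n => by
    simp_rw [eF n]
    have hint : Integrable (fun z : ℝ × E => φ z.1 z.2 * ⟪D n z v, w⟫)
        ((volume : Measure ℝ).prod (volume : Measure E)) := by
      rw [← Measure.volume_eq_prod]
      exact (cφ.mul (((hDc n).clm_apply continuous_const).inner continuous_const))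
        |>.integrable_of_hasCompactSupport
          (HasCompactSupport.intro hKφ fun z hz => by
            show φ z.1 z.2 * ⟪D n z v, w⟫ = 0
            rw [hφ0 z hz, zero_mul])
    rw [Measure.volume_eq_prod, integral_prod _ hint]
  have limL : Tendsto (fun n => ∫ z, ⟪uncurry (V n) z, W z⟫) atTop (𝓝 (∫ z, ⟪ũ z, W z⟫)) :=
    tendsto_integral_inner_of_tendsto_eLpNorm_two mV2 hũ2 cV2 cW sW
  have mF : ∀ n, MemLp (F n) 2 volume := fun n => memLp_indicator_of_continuous (hDc n) hK 2
  have limR : Tendsto (fun n => ∫ z, θ z * ⟪F n z v, w⟫) atTop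
      (𝓝 (∫ z, θ z * ⟪Gt z v, w⟫)) :=
    tendsto_integral_mul_inner_apply_of_tendsto_eLpNorm_two mF hGt hconv cθ sθ v w
  -- the identity in the limit
  have key : (∫ z, ⟪ũ z, W z⟫) = -∫ z, θ z * ⟪Gt z v, w⟫ := by
    refine tendsto_nhds_unique limL (limR.neg.congr fun n => ?_)
    rw [← eR, ← hIBP, eL]
  -- back to iterated integrals of `u` and `G̃`
  have hũu : ∀ z : ℝ × E, ⟪ũ z, W z⟫ = ⟪u z.1 z.2, W z⟫ := fun z => by
    by_cases hz : z ∈ tsupport (uncurry φ)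
    · rw [hũ, zeroExt_of_mem u (hΩ'Ω (hKφΩ' hz))]
    · simp only [hW, hd0 z hz, zero_smul, inner_zero_right]
  have e1 : (∫ t, ∫ x, fderiv ℝ (φ t) x v * ⟪u t x, w⟫) = ∫ z, ⟪ũ z, W z⟫ := by
    have hint : Integrable (fun z : ℝ × E => ⟪u z.1 z.2, W z⟫)
        ((volume : Measure ℝ).prod (volume : Measure E)) := by
      rw [← Measure.volume_eq_prod]
      exact integrable_inner_of_locallyIntegrableOn (hul.mono_set hΩ'Ω) cW hKφ hKφΩ'
        fun z hz => by simp only [hW, hd0 z hz, zero_smul]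
    simp_rw [hũu]
    rw [Measure.volume_eq_prod, integral_prod _ hint]
    refine integral_congr_ae (Eventually.of_forall fun s => integral_congr_ae
      (Eventually.of_forall fun y => ?_))
    simp only [hW, real_inner_smul_right, mul_comm]
  have e2 : (∫ t, ∫ x, φ t x * ⟪Gt (t, x) v, w⟫) = ∫ z, θ z * ⟪Gt z v, w⟫ := by
    have hGl : LocallyIntegrableOn (fun z : ℝ × E => ⟪Gt z v, w⟫) (Ω' : Set (ℝ × E)) volume := by
      have h := locallyIntegrableOn_inner_apply (G := fun t x => Gt (t, x))
        ((hGt.locallyIntegrable one_le_two).locallyIntegrableOn (Ω' : Set (ℝ × E))) v w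
      exact h
    have hint : Integrable (fun z : ℝ × E => ⟪Gt z v, w⟫ * θ z)
        ((volume : Measure ℝ).prod (volume : Measure E)) := by
      rw [← Measure.volume_eq_prod]
      exact integrable_mul_of_locallyIntegrableOn hGl cθ hKφ hKφΩ' hφ0
    have e : (fun z : ℝ × E => θ z * ⟪Gt z v, w⟫) = fun z => ⟪Gt z v, w⟫ * θ z :=
      funext fun z => mul_comm _ _
    rw [e, Measure.volume_eq_prod, integral_prod _ hint]
    refine integral_congr_ae (Eventually.of_forall fun s => integral_congr_ae
      (Eventually.of_forall fun y => ?_))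
    simp only [hθ, mul_comm]
  rw [e1, e2, key]

end Gradient

/-! ### The local energy identity in the limit -/

section Energy

variable {E : Type*} [NormedAddCommGroup E] [InnerProductSpace ℝ E] [FiniteDimensional ℝ E]
  [MeasurableSpace E] [BorelSpace E]

set_option maxHeartbeats 3200000 in
/-- **The local energy identity for bounded distributional solutions.** Let `(u, p)` solve the
unforced Navier–Stokes system (viscosity `ν`) in the sense of distributions on an open
`Ω ⊆ ℝ × E` of finite measure, with `‖u‖ ≤ M` a.e. on `Ω` and `p ∈ L^{3/2}(Ω)`; let `kₙ` be
normalised bump kernels with radii `→ 0`, `K ⊆ Ω` compact, and `𝟙_K D(kₙ ⋆ 𝟙_Ω u) → G̃` in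
`L²` (`exists_L2_limit_mollifiedGradient`). Then for every test function `φ` on `Ω` supported
in `K`, the local energy identity of Caffarelli–Kohn–Nirenberg 1982, (2.5), holds with equality
and with `G̃` in place of `∇u`:
`2ν ∫∫ |G̃|² φ = ∫∫ (|u|² (∂ₜφ + νΔφ) + (|u|² + 2p) u·∇φ)`.
Proof: the smooth local energy identity for the mollified system
(`local_energy_identity_smooth`, with vanishing slice term) passes to the limit term by term;
the transport term through `2 ∫ φ ⟪DV(V), V⟫ = -∫ |V|² ⟪V, ∇φ⟫` for the divergence-free
mollified velocity and the `L²`-vanishing of the commutator `kₙ ⋆ 𝟙_Ω(uᵢu) - (kₙ ⋆ 𝟙_Ω u)ᵢ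
(kₙ ⋆ 𝟙_Ω u)` (`u ∈ L⁴(Ω)`), the dissipation term through the strong `L²` convergence of the
truncated gradients (Seregin–Šverák 2009, §2 p. 6: "it is certainly true in `B × ]-1,-a²[`";
CKN 1982, §2). [cite: SereginSverak2009, §2 p. 6 and Remark 3.4] -/
theorem localEnergyIdentity_of_L2_limit {ν : ℝ}
    {Ω : Opens (ℝ × E)} {u : ℝ → E → E} {p : ℝ → E → ℝ}
    (hNS : IsDistributionalNSSolutionOn Ω ν 0 u p)
    (hΩ : volume (Ω : Set (ℝ × E)) < ∞)
    {M : ℝ} (hM : ∀ᵐ z ∂(volume.restrict (Ω : Set (ℝ × E))), ‖u z.1 z.2‖ ≤ M)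
    (hp : ∫⁻ z in (Ω : Set (ℝ × E)), ‖p z.1 z.2‖ₑ ^ (3 / 2 : ℝ) < ∞)
    {bump : ℕ → ContDiffBump (0 : ℝ × E)} (hbr : Tendsto (fun n => (bump n).rOut) atTop (𝓝 0))
    {K : Set (ℝ × E)} (hK : IsCompact K) (hKΩ : K ⊆ (Ω : Set (ℝ × E)))
    {Gt : ℝ × E → E →L[ℝ] E} (hGt : MemLp Gt 2 volume)
    (hconv : Tendsto (fun n => eLpNorm (K.indicator (fun z : ℝ × E =>
        fderiv ℝ (stMollify ((bump n).normed volume) (zeroExt Ω u) z.1) z.2) - Gt) 2 volume)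
        atTop (𝓝 0))
    {φ : ℝ → E → ℝ} (hφ : IsSpaceTimeTestOn Ω φ) (hφK : tsupport (uncurry φ) ⊆ K) :
    2 * ν * (∫ t, ∫ x, frobeniusNormSq (Gt (t, x)) * φ t x) =
      ∫ t, ∫ x, (‖u t x‖ ^ 2 * (timeDeriv φ t x + ν * Δ (φ t) x) +
        (‖u t x‖ ^ 2 + 2 * p t x) * ⟪u t x, gradient (φ t) x⟫) := by
  haveI : (volume : Measure (ℝ × E)).IsAddHaarMeasure := Measure.prod.instIsAddHaarMeasure _ _
  -- small constants in `ℝ≥0∞`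
  have one_le_three_halves : (1 : ℝ≥0∞) ≤ 3 / 2 := by
    have h : (1 : ℝ≥0∞) = 2 / 2 := (ENNReal.div_self two_ne_zero ENNReal.ofNat_ne_top).symm
    rw [h]
    gcongr
    norm_num
  have three_halves_ne_top : (3 / 2 : ℝ≥0∞) ≠ ∞ := ENNReal.div_ne_top (by norm_num) (by norm_num)
  have three_halves_ne_zero : (3 / 2 : ℝ≥0∞) ≠ 0 :=
    (ENNReal.div_pos (by norm_num) (by norm_num)).ne'
  haveI hHT442 : ENNReal.HolderTriple 4 4 2 := by
    simpa using holderTriple_ofReal (a := 4) (b := 4) (c := 2) (by norm_num) (by norm_num)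
      (by norm_num) (by norm_num)
  haveI hHT24 : ENNReal.HolderTriple 2 4 (4 / 3) := holderTriple_two_four
  haveI hHT41 : ENNReal.HolderTriple (4 / 3) 4 1 := holderTriple_fourThirds_four
  haveI hHT33 : ENNReal.HolderTriple 3 3 (3 / 2) := by
    have h := holderTriple_ofReal (a := 3) (b := 3) (c := 3 / 2) (by norm_num) (by norm_num)
      (by norm_num) (by norm_num)
    rwa [ENNReal.ofReal_ofNat, ENNReal.ofReal_div_of_pos (by norm_num), ENNReal.ofReal_ofNat,
      ENNReal.ofReal_ofNat] at h
  haveI hHT31 : ENNReal.HolderTriple (3 / 2) 3 1 := by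
    have h := holderTriple_ofReal (a := 3 / 2) (b := 3) (c := 1) (by norm_num) (by norm_num)
      (by norm_num) (by norm_num)
    rwa [ENNReal.ofReal_ofNat, ENNReal.ofReal_div_of_pos (by norm_num), ENNReal.ofReal_ofNat,
      ENNReal.ofReal_ofNat, ENNReal.ofReal_one] at h
  haveI hHT22 : ENNReal.HolderTriple 2 2 1 := ENNReal.HolderConjugate.instTwoTwo
  have one_le_43 : (1 : ℝ≥0∞) ≤ 4 / 3 := by
    have h : (1 : ℝ≥0∞) = 3 / 3 := (ENNReal.div_self (by norm_num) (by norm_num)).symm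
    rw [h]; gcongr; norm_num
  set b := stdOrthonormalBasis ℝ E with hb
  -- ## (0) the classes of `u`, `p` on `Ω`
  have hQm : MeasurableSet (Ω : Set (ℝ × E)) := Ω.isOpen.measurableSet
  haveI : IsFiniteMeasure (volume.restrict (Ω : Set (ℝ × E))) :=
    ⟨by rwa [Measure.restrict_apply_univ]⟩
  have hvm : AEStronglyMeasurable (uncurry u) (volume.restrict (Ω : Set (ℝ × E))) :=
    hNS.1.aestronglyMeasurable
  have hpm : AEStronglyMeasurable (uncurry p) (volume.restrict (Ω : Set (ℝ × E))) :=
    hNS.2.2.1.aestronglyMeasurable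
  have huinf : MemLp (uncurry u) ∞ (volume.restrict (Ω : Set (ℝ × E))) :=
    memLp_top_of_bound hvm M hM
  have hu2Q : MemLp (uncurry u) 2 (volume.restrict (Ω : Set (ℝ × E))) := huinf.mono_exponent le_top
  have hu3Q : MemLp (uncurry u) 3 (volume.restrict (Ω : Set (ℝ × E))) := huinf.mono_exponent le_top
  have hu4Q : MemLp (uncurry u) 4 (volume.restrict (Ω : Set (ℝ × E))) := huinf.mono_exponent le_top
  have hpQ : MemLp (uncurry p) (3 / 2) (volume.restrict (Ω : Set (ℝ × E))) := by
    refine memLp_of_lintegral_rpow_lt_top three_halves_ne_zero three_halves_ne_top hpm ?_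
    have : ((3 : ℝ≥0∞) / 2).toReal = 3 / 2 := by
      rw [ENNReal.toReal_div]; norm_num
    rw [this]
    exact hp
  have huI : IntegrableOn (uncurry u) (Ω : Set (ℝ × E)) volume := hu2Q.integrable one_le_two
  have hu2I : IntegrableOn (fun z => ‖uncurry u z‖ ^ 2) (Ω : Set (ℝ × E)) volume :=
    hu2Q.integrable_norm_pow two_ne_zero
  have hpI : IntegrableOn (uncurry p) (Ω : Set (ℝ × E)) volume := hpQ.integrable one_le_three_halves
  -- ## (1) the zero extensions and their whole-space classes
  set ũ : ℝ × E → E := zeroExt Ω u with hũ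
  set pt : ℝ × E → ℝ := zeroExt Ω p with hpt
  set Nt : Fin (finrank ℝ E) → ℝ × E → E := fun i => zeroExt Ω fun s y => ⟪u s y, b i⟫ • u s y
    with hNt
  have hũ2 : MemLp ũ 2 volume := memLp_zeroExt rfl hQm hu2Q
  have hũ3 : MemLp ũ 3 volume := memLp_zeroExt rfl hQm hu3Q
  have hũ4 : MemLp ũ 4 volume := memLp_zeroExt rfl hQm hu4Q
  have hpt32 : MemLp pt (3 / 2) volume := memLp_zeroExt rfl hQm hpQ
  have hNt' : ∀ i, Nt i = fun z => ⟪ũ z, b i⟫ • ũ z := fun i => by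
    rw [hNt]; exact zeroExt_inner_smul u (b i)
  have hNt2 : ∀ i, MemLp (Nt i) 2 volume := fun i => by
    have := memLp_bilin (p := 4) (q := 4) (r := 2) (innerSmulBilin (b i)) hũ4 hũ4
    simpa [hNt' i] using this
  have hũi : LocallyIntegrable ũ volume := locallyIntegrable_zeroExt huI
  have hpti : LocallyIntegrable pt volume := locallyIntegrable_zeroExt hpI
  have hNtli : ∀ i, LocallyIntegrable (Nt i) volume := fun i =>
    locallyIntegrable_zeroExt (integrableOn_inner_smul_self huI hu2I (b i))
  -- ## (2) the mollifiers and the mollified fields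
  set k : ℕ → ℝ × E → ℝ := fun n => (bump n).normed volume with hk
  have hkinf : ∀ n, ContDiff ℝ (⊤ : ℕ∞) (k n) := fun n => (bump n).contDiff_normed
  have hkr : ∀ n w, w ∉ closedBall (0 : ℝ × E) (bump n).rOut → k n w = 0 := fun n w hw => by
    have : w ∉ Function.support (k n) := by
      rw [hk, (bump n).support_normed_eq]; exact fun h => hw (ball_subset_closedBall h)
    simpa using this
  have hkc : ∀ n, HasCompactSupport (k n) := fun n => (bump n).hasCompactSupport_normed
  set V : ℕ → ℝ → E → E := fun n => stMollify (k n) ũ with hV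
  set Pm : ℕ → ℝ → E → ℝ := fun n => stMollify (k n) pt with hPm
  set N : ℕ → Fin (finrank ℝ E) → ℝ → E → E := fun n i => stMollify (k n) (Nt i) with hN
  set D : ℕ → ℝ × E → E →L[ℝ] E := fun n z => fderiv ℝ (V n z.1) z.2 with hD
  set F : ℕ → ℝ × E → E →L[ℝ] E := fun n => K.indicator (D n) with hF
  have hVsm : ∀ n, ContDiff ℝ (⊤ : ℕ∞) (uncurry (V n)) := fun n =>
    contDiff_uncurry_stMollify (hkinf n) (hkc n) hũi
  have hPsm : ∀ n, ContDiff ℝ (⊤ : ℕ∞) (uncurry (Pm n)) := fun n =>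
    contDiff_uncurry_stMollify (hkinf n) (hkc n) hpti
  have hNsm : ∀ n i, ContDiff ℝ (⊤ : ℕ∞) (uncurry (N n i)) := fun n i =>
    contDiff_uncurry_stMollify (hkinf n) (hkc n) (hNtli i)
  have hVc : ∀ n, Continuous (uncurry (V n)) := fun n => (hVsm n).continuous
  have hPc : ∀ n, Continuous (uncurry (Pm n)) := fun n => (hPsm n).continuous
  have hNc : ∀ n i, Continuous (uncurry (N n i)) := fun n i => (hNsm n i).continuous
  have hDc : ∀ n, Continuous (D n) := fun n => by
    have sV : IsSmoothSpaceTimeOn univ (V n) := (hVsm n).contDiffOn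
    exact (sV.fderiv_slice uniqueDiffOn_univ).continuous_uncurry
  -- whole-space convergence and classes of the mollifications
  have cV2 : Tendsto (fun n => eLpNorm (uncurry (V n) - ũ) 2 volume) atTop (𝓝 0) :=
    FunctionSpaces.tendsto_eLpNorm_normed_convolution_sub_self hbr (by norm_num) (by norm_num) hũ2
  have cV3 : Tendsto (fun n => eLpNorm (uncurry (V n) - ũ) 3 volume) atTop (𝓝 0) :=
    FunctionSpaces.tendsto_eLpNorm_normed_convolution_sub_self hbr (by norm_num) (by norm_num) hũ3
  have cV4 : Tendsto (fun n => eLpNorm (uncurry (V n) - ũ) 4 volume) atTop (𝓝 0) :=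
    FunctionSpaces.tendsto_eLpNorm_normed_convolution_sub_self hbr (by norm_num) (by norm_num) hũ4
  have cP : Tendsto (fun n => eLpNorm (uncurry (Pm n) - pt) (3 / 2) volume) atTop (𝓝 0) :=
    FunctionSpaces.tendsto_eLpNorm_normed_convolution_sub_self hbr one_le_three_halves
      three_halves_ne_top hpt32
  have cN : ∀ i, Tendsto (fun n => eLpNorm (uncurry (N n i) - Nt i) 2 volume) atTop (𝓝 0) :=
    fun i => FunctionSpaces.tendsto_eLpNorm_normed_convolution_sub_self hbr (by norm_num)
      (by norm_num) (hNt2 i)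
  have mV2 : ∀ n, MemLp (uncurry (V n)) 2 volume := fun n =>
    UnboundedOperators.memLp_convolution_lsmul (bump n).integrable_normed hũ2 (by norm_num)
  have mV3 : ∀ n, MemLp (uncurry (V n)) 3 volume := fun n =>
    UnboundedOperators.memLp_convolution_lsmul (bump n).integrable_normed hũ3 (by norm_num)
  have mV4 : ∀ n, MemLp (uncurry (V n)) 4 volume := fun n =>
    UnboundedOperators.memLp_convolution_lsmul (bump n).integrable_normed hũ4 (by norm_num)
  have mP : ∀ n, MemLp (uncurry (Pm n)) (3 / 2) volume := fun n =>
    UnboundedOperators.memLp_convolution_lsmul (bump n).integrable_normed hpt32 one_le_three_halves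
  have mN : ∀ n i, MemLp (uncurry (N n i)) 2 volume := fun n i =>
    UnboundedOperators.memLp_convolution_lsmul (bump n).integrable_normed (hNt2 i) (by norm_num)
  have mF : ∀ n, MemLp (F n) 2 volume := fun n => memLp_indicator_of_continuous (hDc n) hK 2
  -- the commutators `Cₙᵢ = Nₙᵢ - (Vₙ)ᵢ Vₙ`
  set C : ℕ → Fin (finrank ℝ E) → ℝ × E → E := fun n i z =>
    uncurry (N n i) z - innerSmulBilin (b i) (uncurry (V n) z) (uncurry (V n) z) with hC
  have mVV : ∀ n i, MemLp (fun z => innerSmulBilin (b i) (uncurry (V n) z) (uncurry (V n) z)) 2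
      volume := fun n i => memLp_bilin (p := 4) (q := 4) (r := 2) (innerSmulBilin (b i)) (mV4 n) (mV4 n)
  have mC : ∀ n i, MemLp (C n i) 2 volume := fun n i => (mN n i).sub (mVV n i)
  have cC : ∀ i, Tendsto (fun n => eLpNorm (C n i - 0) 2 volume) atTop (𝓝 0) := by
    intro i
    have h1 := tendsto_eLpNorm_bilin_sub (p := 4) (q := 4) (r := 2) (by norm_num) (by norm_num)
      (innerSmulBilin (b i)) (fun n => (mV4 n).1) hũ4.1 (fun n => (mV4 n).1) hũ4.1
      hũ4.eLpNorm_lt_top hũ4.eLpNorm_lt_top cV4 cV4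
    have hb' : ∀ n, eLpNorm (C n i - 0) 2 volume ≤ eLpNorm (uncurry (N n i) - Nt i) 2 volume +
        eLpNorm (fun z => innerSmulBilin (b i) (uncurry (V n) z) (uncurry (V n) z) -
          innerSmulBilin (b i) (ũ z) (ũ z)) 2 volume := by
      intro n
      have e : C n i - 0 = (uncurry (N n i) - Nt i) -
          fun z => innerSmulBilin (b i) (uncurry (V n) z) (uncurry (V n) z) -
            innerSmulBilin (b i) (ũ z) (ũ z) := by
        funext z
        simp only [hC, hNt' i, Pi.sub_apply, Pi.zero_apply, innerSmulBilin_apply, sub_zero]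
        abel
      rw [e]
      exact eLpNorm_sub_le ((mN n i).1.sub (hNt2 i).1) ((mVV n i).1.sub
        (memLp_bilin (p := 4) (q := 4) (r := 2) (innerSmulBilin (b i)) hũ4 hũ4).1) one_le_two
    have hlim : Tendsto (fun n => eLpNorm (uncurry (N n i) - Nt i) 2 volume +
        eLpNorm (fun z => innerSmulBilin (b i) (uncurry (V n) z) (uncurry (V n) z) -
          innerSmulBilin (b i) (ũ z) (ũ z)) 2 volume) atTop (𝓝 0) := by
      simpa using (cN i).add h1
    exact tendsto_of_tendsto_of_tendsto_of_le_of_le tendsto_const_nhds hlim (fun n => zero_le) hb'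
  -- ## (3) support geometry of `φ`, the margins and the time bounds
  set Kφ : Set (ℝ × E) := tsupport (uncurry φ) with hKφ_def
  have hKφ : IsCompact Kφ := hφ.hasCompactSupport
  obtain ⟨δ, hδ, hδΩ⟩ := hK.exists_cthickening_subset_open Ω.isOpen hKΩ
  have hball : ∀ z ∈ Kφ, ∀ ρ, ρ ≤ δ → closedBall z ρ ⊆ (Ω : Set (ℝ × E)) := fun z hz ρ hρ =>
    ((closedBall_subset_cthickening (hφK hz) ρ).trans (cthickening_mono hρ _)).trans hδΩ
  obtain ⟨a₀, b₀, hab⟩ : ∃ a₀ b₀ : ℝ, ∀ s, s ∉ Icc a₀ b₀ → φ s = 0 := by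
    have h1 : IsCompact (Prod.fst '' tsupport (uncurry φ)) :=
      hφ.hasCompactSupport.image continuous_fst
    obtain ⟨b₀, hb₀⟩ := h1.isBounded.bddAbove
    obtain ⟨a₀, ha₀⟩ := h1.isBounded.bddBelow
    refine ⟨a₀, b₀, fun s hs => funext fun y => ?_⟩
    by_contra hy
    have hmem : (s, y) ∈ tsupport (uncurry φ) := subset_tsupport _ hy
    exact hs ⟨ha₀ ⟨(s, y), hmem, rfl⟩, hb₀ ⟨(s, y), hmem, rfl⟩⟩
  set a : ℝ := a₀ - 1 with ha
  set t : ℝ := max a₀ b₀ + 1 with ht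
  have hat : a ≤ t := by
    rw [ha, ht]; linarith [le_max_left a₀ b₀]
  have hφa : ∀ y, φ a y = 0 := fun y => by
    have h := hab a (fun h => by rw [ha] at h; linarith [h.1])
    exact congrFun h y
  have hφt : ∀ y, φ t y = 0 := fun y => by
    have h := hab t (fun h => by rw [ht] at h; linarith [h.2, le_max_right a₀ b₀])
    exact congrFun h y
  have hφS : ∀ z : ℝ × E, z ∉ Ioo a t ×ˢ (univ : Set E) → z ∉ Kφ := fun z hz hzK => by
    have hz' : z.1 ∉ Ioo a t := fun h => hz ⟨h, mem_univ _⟩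
    have hne : φ z.1 z.2 ≠ 0 → False := fun hne => by
      have h := hab z.1 (fun h => hz' ⟨by rw [ha]; linarith [h.1],
        by rw [ht]; linarith [h.2, le_max_right a₀ b₀]⟩)
      exact hne (congrFun h z.2)
    -- points of the support with `z.1 ∉ (a, t)`: all slices between vanish identically there
    have hzero : ∀ s, s ∉ Ioo a t → φ s = 0 := fun s hs =>
      hab s (fun h => hs ⟨by rw [ha]; linarith [h.1], by rw [ht]; linarith [h.2, le_max_right a₀ b₀]⟩)
    -- the open set `{w | w.1 ∉ [a', t']}`... use: `φ` vanishes on the open neighbourhood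
    -- `(Ioo a t)ᶜ`-interior of `z`: since `z.1 ∉ Ioo a t` means `z.1 ≤ a` or `t ≤ z.1`, and
    -- `φ s = 0` for all `s ≤ a₀ - 1/2`... simpler: `z ∈ tsupport` forces `a₀ ≤ z.1 ≤ b₀`.
    have hmem : z.1 ∈ Icc a₀ b₀ := by
      by_contra hc
      -- `φ` vanishes identically on the open strip `(Icc a₀ b₀)ᶜ ×ˢ univ` containing `z`
      have hopen : IsOpen ((Icc a₀ b₀)ᶜ ×ˢ (univ : Set E)) := isClosed_Icc.isOpen_compl.prod isOpen_univ
      have hzmem : z ∈ (Icc a₀ b₀)ᶜ ×ˢ (univ : Set E) := ⟨hc, mem_univ _⟩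
      have hvan : ∀ w ∈ (Icc a₀ b₀)ᶜ ×ˢ (univ : Set E), uncurry φ w = 0 := fun w hw => by
        have := hab w.1 hw.1
        exact congrFun this w.2
      have : z ∉ tsupport (uncurry φ) := by
        rw [← hKφ_def] at *
        intro hz2
        have hnhds : (Icc a₀ b₀)ᶜ ×ˢ (univ : Set E) ∈ 𝓝 z := hopen.mem_nhds hzmem
        have : uncurry φ =ᶠ[𝓝 z] 0 := Filter.eventually_of_mem hnhds hvan
        exact (notMem_tsupport_iff_eventuallyEq.2 this) hz2
      exact this hzK
    exact hz' ⟨by rw [ha]; linarith [hmem.1], by rw [ht]; linarith [hmem.2, le_max_right a₀ b₀]⟩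
  set S : Set (ℝ × E) := Ioo a t ×ˢ (univ : Set E) with hS
  have hSm : MeasurableSet S := measurableSet_Ioo.prod MeasurableSet.univ
  -- ### (b) the mollified equations on `{φ ≠ 0}`, and the energy identity
  have hEQ : ∀ n, (bump n).rOut ≤ δ → ∀ s y, φ s y ≠ 0 →
      (∀ i, ⟪timeDeriv (V n) s y, b i⟫ + VectorCalculus.divergence (N n i s) y -
        ν * ⟪(Δ (V n s)) y, b i⟫ + fderiv ℝ (Pm n s) y (b i) = 0) ∧
      VectorCalculus.divergence (V n s) y = 0 := by
    intro n hn s y hy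
    have hz : (s, y) ∈ Kφ := subset_tsupport _ (by exact hy)
    have hsub : closedBall ((s, y) : ℝ × E) (bump n).rOut ⊆ (Ω : Set (ℝ × E)) :=
      hball _ hz _ hn
    exact ⟨fun i => hNS.mollified_momentum huI hu2I hpI (hkinf n) (hkr n) hsub (b i),
      hNS.divergence_mollified_eq_zero huI (hkinf n) (hkr n) hsub⟩
  have hID : ∀ n, (bump n).rOut ≤ δ →
      2 * ν * (∫ z in S, φ z.1 z.2 * frobeniusNormSq (fderiv ℝ (V n z.1) z.2)) =
      ∫ z in S, (‖V n z.1 z.2‖ ^ 2 * (ν * (Δ (φ z.1)) z.2 + timeDeriv φ z.1 z.2) +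
        2 * (∑ i, (⟪N n i z.1 z.2, gradient (φ z.1) z.2⟫ * ⟪V n z.1 z.2, b i⟫ +
          φ z.1 z.2 * ⟪fderiv ℝ (V n z.1) z.2 (N n i z.1 z.2), b i⟫)) +
        2 * (Pm n z.1 z.2 * ⟪V n z.1 z.2, gradient (φ z.1) z.2⟫)) := by
    intro n hn
    have h := local_energy_identity_smooth b (ν := ν) hat (hVsm n) (hNsm n) (hPsm n) hφ hφa
      (fun s _ y hy => (hEQ n hn s y hy).1) (fun s _ y hy => (hEQ n hn s y hy).2)
    have h0 : ∫ y, φ t y * ‖V n t y‖ ^ 2 = 0 := by simp [hφt]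
    rw [h0, zero_add] at h
    exact h
  -- ### (c) weights, bilinear forms
  obtain ⟨Kx, hKx, hKxt⟩ := hφ.exists_compact_slice_subset
  have hφKx : ∀ s, ∀ y ∉ Kx, φ s y = 0 := fun s y hy =>
    image_eq_zero_of_notMem_tsupport fun h => hy (hKxt s h)
  have sφ : IsSmoothSpaceTimeOn univ φ := hφ.isSmoothSpaceTimeOn univ
  have cφ : Continuous (uncurry φ) := hφ.contDiff.continuous
  have cgφ : Continuous (uncurry fun s y => gradient (φ s) y) :=
    (sφ.gradient uniqueDiffOn_univ).continuous_uncurry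
  have cΔφ : Continuous (uncurry fun s y => (Δ (φ s)) y) :=
    (sφ.laplacian uniqueDiffOn_univ).continuous_uncurry
  have cTφ : Continuous (uncurry (timeDeriv φ)) := hφ.continuous_timeDeriv
  have hg0 : ∀ s, ∀ y ∉ Kx, gradient (φ s) y = 0 := fun s y hy =>
    gradient_eq_zero_of_notMem_tsupport fun h => hy (hKxt s h)
  set wΔ : ℝ × E → ℝ := fun z => ν * (Δ (φ z.1)) z.2 + timeDeriv φ z.1 z.2 with hwΔ
  set wφ : ℝ × E → ℝ := fun z => φ z.1 z.2 with hwφ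
  set wg : ℝ × E → E →L[ℝ] ℝ := fun z => innerSL ℝ (gradient (φ z.1) z.2) with hwg
  have cwΔ : Continuous wΔ := (continuous_const.mul cΔφ).add cTφ
  have cwg : Continuous wg := (innerSL ℝ).continuous.comp cgφ
  have hsuppφ : HasCompactSupport (uncurry φ) := hφ.hasCompactSupport
  have hw0 : ∀ z, z ∉ Kφ → wφ z = 0 ∧ wg z = 0 ∧ wΔ z = 0 := fun z hz => by
    obtain ⟨h1, h2, h3, h4⟩ := weights_eq_zero_of_notMem_tsupport hz
    refine ⟨h1, ?_, ?_⟩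
    · simp only [hwg, h2, map_zero]
    · simp only [hwΔ, h3, h4, mul_zero, add_zero]
  obtain ⟨CΔ, hCΔ⟩ := cwΔ.bounded_above_of_compact_support
    (hsuppφ.mono' fun z hz => by by_contra h; exact hz (hw0 z h).2.2)
  obtain ⟨Cφ, hCφ⟩ := cφ.bounded_above_of_compact_support hsuppφ
  obtain ⟨Cg, hCg⟩ := cwg.bounded_above_of_compact_support
    (hsuppφ.mono' fun z hz => by by_contra h; exact hz (hw0 z h).2.1)
  have mwΔ : AEStronglyMeasurable wΔ volume := cwΔ.aestronglyMeasurable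
  have mwφ : AEStronglyMeasurable wφ volume := cφ.aestronglyMeasurable
  have mwg : AEStronglyMeasurable wg volume := cwg.aestronglyMeasurable
  have bwΔ : ∀ᵐ z ∂(volume : Measure (ℝ × E)), ‖wΔ z‖ ≤ CΔ := Eventually.of_forall hCΔ
  have bwφ : ∀ᵐ z ∂(volume : Measure (ℝ × E)), ‖wφ z‖ ≤ Cφ := Eventually.of_forall hCφ
  have bwg : ∀ᵐ z ∂(volume : Measure (ℝ × E)), ‖wg z‖ ≤ Cg := Eventually.of_forall hCg
  set βI : E →L[ℝ] E →L[ℝ] ℝ := innerSL ℝ with hβI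
  set βev : (E →L[ℝ] E) →L[ℝ] E →L[ℝ] E := ContinuousLinearMap.id ℝ (E →L[ℝ] E) with hβev
  set βb : Fin (finrank ℝ E) → (E →L[ℝ] E) →L[ℝ] E →L[ℝ] ℝ := fun i =>
    (ContinuousLinearMap.compL ℝ E E ℝ (innerSL ℝ (b i))) with hβb
  set βF : Fin (finrank ℝ E) → (E →L[ℝ] E) →L[ℝ] (E →L[ℝ] E) →L[ℝ] ℝ := fun i =>
    (innerSL ℝ).bilinearComp (ContinuousLinearMap.apply ℝ E (b i))
      (ContinuousLinearMap.apply ℝ E (b i)) with hβF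
  set βs : ℝ →L[ℝ] E →L[ℝ] E := ContinuousLinearMap.lsmul ℝ ℝ with hβs
  have βb_apply : ∀ i (L : E →L[ℝ] E) (x : E), βb i L x = ⟪b i, L x⟫ := fun i L x => by
    simp [hβb]
  have βF_apply : ∀ i (L L' : E →L[ℝ] E), βF i L L' = ⟪L (b i), L' (b i)⟫ := fun i L L' => by
    simp [hβF]
  have βI_apply : ∀ x y : E, βI x y = ⟪x, y⟫ := fun x y => rfl
  have βs_apply : ∀ (c : ℝ) (x : E), βs c x = c • x := fun c x => rfl
  have βev_apply : ∀ (L : E →L[ℝ] E) (x : E), βev L x = L x := fun L x => rfl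
  have wg_apply : ∀ (z : ℝ × E) (x : E), wg z x = ⟪gradient (φ z.1) z.2, x⟫ := fun z x => rfl
  -- ### (c') the transport identity `2 ∫∫ φ ⟪DV V, V⟫ = -∫∫ |V|² ⟪V, ∇φ⟫`
  have hDAG : ∀ n, (bump n).rOut ≤ δ →
      2 * (∫ z in S, φ z.1 z.2 * ⟪fderiv ℝ (V n z.1) z.2 (V n z.1 z.2), V n z.1 z.2⟫) =
      -∫ z in S, ‖V n z.1 z.2‖ ^ 2 * ⟪V n z.1 z.2, gradient (φ z.1) z.2⟫ := by
    intro n hn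
    have cL : Continuous fun z : ℝ × E =>
        φ z.1 z.2 * ⟪fderiv ℝ (V n z.1) z.2 (V n z.1 z.2), V n z.1 z.2⟫ :=
      cφ.mul ((isBoundedBilinearMap_apply.continuous.comp ((hDc n).prodMk (hVc n))).inner (hVc n))
    have cR : Continuous fun z : ℝ × E => ‖V n z.1 z.2‖ ^ 2 * ⟪V n z.1 z.2, gradient (φ z.1) z.2⟫ :=
      (((hVc n).norm).pow 2).mul ((hVc n).inner cgφ)
    have iL := integrable_prod_of_continuousOn (a := a) (b := t) hKx cL.continuousOn
      (fun s _ y hy => by simp only [hφKx s y hy, zero_mul])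
    have iR := integrable_prod_of_continuousOn (a := a) (b := t) hKx cR.continuousOn
      (fun s _ y hy => by simp only [hg0 s y hy, inner_zero_right, mul_zero])
    have hsl' : ∀ s ∈ Ioo a t, 2 * ∫ y, φ s y * ⟪fderiv ℝ (V n s) y (V n s y), V n s y⟫ =
        -∫ y, ‖V n s y‖ ^ 2 * ⟪V n s y, gradient (φ s) y⟫ := by
      intro s hs
      have hV1 : ContDiff ℝ 1 (V n s) :=
        (contDiff_stMollify_slice (hkinf n) (hkc n) hũi s).of_le one_le_infty
      have hφ1 : ContDiff ℝ 1 (φ s) :=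
        (IsSpaceTimeTestOn.contDiff_slice hφ s).of_le one_le_infty
      exact two_mul_integral_mul_inner_fderiv_self hV1 hφ1 (hφ.hasCompactSupport_slice s)
        (fun y hy => (hEQ n hn s y hy).2)
    rw [setIntegral_prod_univ_eq iL, setIntegral_prod_univ_eq iR, ← integral_neg,
      ← integral_const_mul]
    refine setIntegral_congr_fun measurableSet_Ioo fun s hs => ?_
    exact hsl' s hs
  -- ### (d) passage to the limit
  have limT1 : Tendsto (fun n => ∫ z in S, wΔ z * βI (uncurry (V n) z) (uncurry (V n) z))
      atTop (𝓝 (∫ z in S, wΔ z * βI (ũ z) (ũ z))) :=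
    tendsto_setIntegral_mul_bilin (p := 2) (q := 2) one_le_two βI mV2 hũ2 mV2 hũ2 cV2 cV2 mwΔ
      bwΔ S
  have limT2a : ∀ i, Tendsto (fun n => ∫ z in S,
      wg z (innerSmulBilin (b i) (uncurry (V n) z) (uncurry (N n i) z))) atTop
      (𝓝 (∫ z in S, wg z (innerSmulBilin (b i) (ũ z) (Nt i z)))) := fun i =>
    tendsto_setIntegral_clm_bilin (p := 2) (q := 2) one_le_two (innerSmulBilin (b i))
      mV2 hũ2 (fun n => mN n i) (hNt2 i) cV2 (cN i) mwg bwg S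
  have limCOMM : ∀ i, Tendsto (fun n => ∫ z in S, wφ z * βb i (F n z) (C n i z)) atTop
      (𝓝 0) := fun i => by
    have h := tendsto_setIntegral_mul_bilin (p := 2) (q := 2) one_le_two (βb i) mF hGt
      (fun n => mC n i) (MemLp.zero (ε := E)) hconv (cC i) mwφ bwφ S
    simpa using h
  have limL2 : ∀ i, Tendsto (fun n => ∫ z in S, wφ z * βF i (F n z) (F n z)) atTop
      (𝓝 (∫ z in S, wφ z * βF i (Gt z) (Gt z))) := fun i =>
    tendsto_setIntegral_mul_bilin (p := 2) (q := 2) one_le_two (βF i) mF hGt mF hGt hconv hconv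
      mwφ bwφ S
  have limT3 : Tendsto (fun n => ∫ z in S, wg z (βs (uncurry (Pm n) z) (uncurry (V n) z))) atTop
      (𝓝 (∫ z in S, wg z (βs (pt z) (ũ z)))) :=
    tendsto_setIntegral_clm_bilin (p := 3 / 2) (q := 3) (by norm_num) βs mP hpt32 mV3 hũ3 cP cV3
      mwg bwg S
  have msq : ∀ n, MemLp (fun z => βI (uncurry (V n) z) (uncurry (V n) z)) (3 / 2) volume :=
    fun n => memLp_bilin (p := 3) (q := 3) (r := 3 / 2) βI (mV3 n) (mV3 n)
  have msq0 : MemLp (fun z => βI (ũ z) (ũ z)) (3 / 2) volume :=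
    memLp_bilin (p := 3) (q := 3) (r := 3 / 2) βI hũ3 hũ3
  have csq : Tendsto (fun n => eLpNorm ((fun z => βI (uncurry (V n) z) (uncurry (V n) z)) -
      fun z => βI (ũ z) (ũ z)) (3 / 2) volume) atTop (𝓝 0) :=
    tendsto_eLpNorm_bilin_sub (p := 3) (q := 3) (r := 3 / 2) (by norm_num) one_le_three_halves βI
      (fun n => (mV3 n).1) hũ3.1 (fun n => (mV3 n).1) hũ3.1 hũ3.eLpNorm_lt_top
      hũ3.eLpNorm_lt_top cV3 cV3
  have limDR : Tendsto (fun n => ∫ z in S, wg z (βs (βI (uncurry (V n) z) (uncurry (V n) z))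
      (uncurry (V n) z))) atTop (𝓝 (∫ z in S, wg z (βs (βI (ũ z) (ũ z)) (ũ z)))) :=
    tendsto_setIntegral_clm_bilin (p := 3 / 2) (q := 3) (by norm_num) βs msq msq0 mV3 hũ3 csq cV3
      mwg bwg S
  -- ### (d2) the identities in `T`-form for large `n`
  have hFD : ∀ n, ∀ z ∈ Kφ, F n z = D n z := fun n z hz => by
    simp only [hF, indicator_of_mem (hφK hz)]
  -- pointwise rewriting of the integrands
  have pwL2 : ∀ n (z : ℝ × E), φ z.1 z.2 * frobeniusNormSq (fderiv ℝ (V n z.1) z.2) =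
      ∑ i, wφ z * βF i (F n z) (F n z) := by
    intro n z
    by_cases hzs : z ∈ Kφ
    · rw [hFD n z hzs, frobeniusNormSq_eq_sum b, Finset.mul_sum]
      refine Finset.sum_congr rfl fun i _ => ?_
      rw [βF_apply, real_inner_self_eq_norm_sq]
    · have h0 := (hw0 z hzs).1
      simp only [hwφ] at h0 ⊢
      simp [h0]
  have pwR : ∀ n (z : ℝ × E),
      (‖V n z.1 z.2‖ ^ 2 * (ν * (Δ (φ z.1)) z.2 + timeDeriv φ z.1 z.2) +
        2 * (∑ i, (⟪N n i z.1 z.2, gradient (φ z.1) z.2⟫ * ⟪V n z.1 z.2, b i⟫ +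
          φ z.1 z.2 * ⟪fderiv ℝ (V n z.1) z.2 (N n i z.1 z.2), b i⟫)) +
        2 * (Pm n z.1 z.2 * ⟪V n z.1 z.2, gradient (φ z.1) z.2⟫)) =
      wΔ z * βI (uncurry (V n) z) (uncurry (V n) z) +
        2 * ((∑ i, (wg z (innerSmulBilin (b i) (uncurry (V n) z) (uncurry (N n i) z)) +
          wφ z * βb i (F n z) (C n i z))) +
          wφ z * βI (βev (F n z) (uncurry (V n) z)) (uncurry (V n) z)) +
        2 * wg z (βs (uncurry (Pm n) z) (uncurry (V n) z)) := by
    intro n z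
    have e1 : ‖V n z.1 z.2‖ ^ 2 * (ν * (Δ (φ z.1)) z.2 + timeDeriv φ z.1 z.2) =
        wΔ z * βI (uncurry (V n) z) (uncurry (V n) z) := by
      rw [βI_apply, real_inner_self_eq_norm_sq, mul_comm]
      simp only [hwΔ, uncurry]
    have e3 : Pm n z.1 z.2 * ⟪V n z.1 z.2, gradient (φ z.1) z.2⟫ =
        wg z (βs (uncurry (Pm n) z) (uncurry (V n) z)) := by
      rw [wg_apply, βs_apply, real_inner_smul_right, real_inner_comm]
      simp only [uncurry]
    have e2a : ∀ i, ⟪N n i z.1 z.2, gradient (φ z.1) z.2⟫ * ⟪V n z.1 z.2, b i⟫ =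
        wg z (innerSmulBilin (b i) (uncurry (V n) z) (uncurry (N n i) z)) := fun i => by
      rw [wg_apply, innerSmulBilin_apply, real_inner_smul_right]
      simp only [uncurry]
      rw [real_inner_comm (N n i z.1 z.2) (gradient (φ z.1) z.2)]
      ring
    have e2b : (∑ i, φ z.1 z.2 * ⟪fderiv ℝ (V n z.1) z.2 (N n i z.1 z.2), b i⟫) =
        (∑ i, wφ z * βb i (F n z) (C n i z)) +
          wφ z * βI (βev (F n z) (uncurry (V n) z)) (uncurry (V n) z) := by
      by_cases hzs : z ∈ Kφ
      · rw [hFD n z hzs]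
        have e : ∀ i, φ z.1 z.2 * ⟪fderiv ℝ (V n z.1) z.2 (N n i z.1 z.2), b i⟫ =
            wφ z * βb i (D n z) (C n i z) +
              wφ z * (⟪V n z.1 z.2, b i⟫ * ⟪b i, D n z (V n z.1 z.2)⟫) := fun i => by
          rw [βb_apply]
          simp only [hwφ, hC, hD, uncurry, innerSmulBilin_apply, map_sub, map_smul,
            inner_sub_right, real_inner_smul_right]
          rw [real_inner_comm (b i)]
          ring
        have esum : (∑ i, wφ z * (⟪V n z.1 z.2, b i⟫ * ⟪b i, D n z (V n z.1 z.2)⟫)) =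
            wφ z * βI (βev (D n z) (uncurry (V n) z)) (uncurry (V n) z) := by
          rw [← Finset.mul_sum, b.sum_inner_mul_inner, βI_apply, βev_apply]
          simp only [uncurry]
          rw [real_inner_comm]
        rw [Finset.sum_congr rfl fun i _ => e i, Finset.sum_add_distrib, esum]
      · have h0 : φ z.1 z.2 = 0 := (hw0 z hzs).1
        have h0' : wφ z = 0 := (hw0 z hzs).1
        simp only [h0, h0', zero_mul, Finset.sum_const_zero, add_zero]
    rw [e1, e3, Finset.sum_add_distrib, Finset.sum_congr rfl fun i _ => e2a i, e2b,
      Finset.sum_add_distrib]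
    ring
  have pwDL : ∀ n (z : ℝ × E), φ z.1 z.2 * ⟪fderiv ℝ (V n z.1) z.2 (V n z.1 z.2), V n z.1 z.2⟫ =
      wφ z * βI (βev (F n z) (uncurry (V n) z)) (uncurry (V n) z) := by
    intro n z
    by_cases hzs : z ∈ Kφ
    · rw [hFD n z hzs]; rfl
    · have h0 := (hw0 z hzs).1
      simp only [hwφ] at h0 ⊢
      simp [h0]
  have pwDR : ∀ n (z : ℝ × E), ‖V n z.1 z.2‖ ^ 2 * ⟪V n z.1 z.2, gradient (φ z.1) z.2⟫ =
      wg z (βs (βI (uncurry (V n) z) (uncurry (V n) z)) (uncurry (V n) z)) := by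
    intro n z
    rw [wg_apply, βs_apply, βI_apply, real_inner_smul_right, real_inner_self_eq_norm_sq,
      real_inner_comm]
    simp only [uncurry]
  -- integrability of the pieces
  have iT2a : ∀ n i, Integrable (fun z => wg z (innerSmulBilin (b i) (uncurry (V n) z)
      (uncurry (N n i) z))) (volume : Measure (ℝ × E)) := fun n i =>
    integrable_clm_bilin_of_memLp (p := 2) (q := 2) _ (mV2 n) (mN n i) mwg bwg
  have iCOMM : ∀ n i, Integrable (fun z => wφ z * βb i (F n z) (C n i z))
      (volume : Measure (ℝ × E)) := fun n i =>
    integrable_mul_bilin_of_memLp (p := 2) (q := 2) _ (mF n) (mC n i) mwφ bwφ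
  have iT1 : ∀ n, Integrable (fun z => wΔ z * βI (uncurry (V n) z) (uncurry (V n) z))
      (volume : Measure (ℝ × E)) := fun n =>
    integrable_mul_bilin_of_memLp (p := 2) (q := 2) _ (mV2 n) (mV2 n) mwΔ bwΔ
  have iT3 : ∀ n, Integrable (fun z => wg z (βs (uncurry (Pm n) z) (uncurry (V n) z)))
      (volume : Measure (ℝ × E)) := fun n =>
    integrable_clm_bilin_of_memLp (p := 3 / 2) (q := 3) _ (mP n) (mV3 n) mwg bwg
  have iL2 : ∀ n i, Integrable (fun z => wφ z * βF i (F n z) (F n z))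
      (volume : Measure (ℝ × E)) := fun n i =>
    integrable_mul_bilin_of_memLp (p := 2) (q := 2) _ (mF n) (mF n) mwφ bwφ
  have mAm : ∀ n, MemLp (fun z => βev (F n z) (uncurry (V n) z)) (4 / 3) volume := fun n =>
    memLp_bilin (p := 2) (q := 4) (r := 4 / 3) βev (mF n) (mV4 n)
  have iDL : ∀ n, Integrable (fun z => wφ z * βI (βev (F n z) (uncurry (V n) z)) (uncurry (V n) z))
      (volume : Measure (ℝ × E)) := fun n =>
    integrable_mul_bilin_of_memLp (p := 4 / 3) (q := 4) _ (mAm n) (mV4 n) mwφ bwφ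
  have iDR : ∀ n, Integrable (fun z => wg z (βs (βI (uncurry (V n) z) (uncurry (V n) z))
      (uncurry (V n) z))) (volume : Measure (ℝ × E)) := fun n =>
    integrable_clm_bilin_of_memLp (p := 3 / 2) (q := 3) _ (msq n) (mV3 n) mwg bwg
  -- the identities in `T`-form
  have hIDT : ∀ n, (bump n).rOut ≤ δ →
      2 * ν * ∑ i, ∫ z in S, wφ z * βF i (F n z) (F n z) =
      (∫ z in S, wΔ z * βI (uncurry (V n) z) (uncurry (V n) z)) +
        2 * ((∑ i, ∫ z in S, wg z (innerSmulBilin (b i) (uncurry (V n) z) (uncurry (N n i) z))) +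
          ∑ i, ∫ z in S, wφ z * βb i (F n z) (C n i z)) -
        (∫ z in S, wg z (βs (βI (uncurry (V n) z) (uncurry (V n) z)) (uncurry (V n) z))) +
        2 * ∫ z in S, wg z (βs (uncurry (Pm n) z) (uncurry (V n) z)) := by
    intro n hn
    have h := hID n hn
    have hd := hDAG n hn
    -- left-hand side
    have eL2 : (∫ z in S, φ z.1 z.2 * frobeniusNormSq (fderiv ℝ (V n z.1) z.2)) =
        ∑ i, ∫ z in S, wφ z * βF i (F n z) (F n z) := by
      rw [integral_congr_ae (Eventually.of_forall (pwL2 n)),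
        integral_finsetSum _ fun i _ => (iL2 n i).integrableOn]
    -- the transport identity in `T`-form
    have hdT : 2 * (∫ z in S, wφ z * βI (βev (F n z) (uncurry (V n) z)) (uncurry (V n) z)) =
        -∫ z in S, wg z (βs (βI (uncurry (V n) z) (uncurry (V n) z)) (uncurry (V n) z)) := by
      rw [integral_congr_ae (Eventually.of_forall (pwDL n)),
        integral_congr_ae (Eventually.of_forall (pwDR n))] at hd
      exact hd
    -- right-hand side
    have eR : (∫ z in S, (‖V n z.1 z.2‖ ^ 2 * (ν * (Δ (φ z.1)) z.2 + timeDeriv φ z.1 z.2) +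
        2 * (∑ i, (⟪N n i z.1 z.2, gradient (φ z.1) z.2⟫ * ⟪V n z.1 z.2, b i⟫ +
          φ z.1 z.2 * ⟪fderiv ℝ (V n z.1) z.2 (N n i z.1 z.2), b i⟫)) +
        2 * (Pm n z.1 z.2 * ⟪V n z.1 z.2, gradient (φ z.1) z.2⟫))) =
        (∫ z in S, wΔ z * βI (uncurry (V n) z) (uncurry (V n) z)) +
        2 * (((∑ i, ∫ z in S, wg z (innerSmulBilin (b i) (uncurry (V n) z) (uncurry (N n i) z))) +
          ∑ i, ∫ z in S, wφ z * βb i (F n z) (C n i z)) +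
          ∫ z in S, wφ z * βI (βev (F n z) (uncurry (V n) z)) (uncurry (V n) z)) +
        2 * ∫ z in S, wg z (βs (uncurry (Pm n) z) (uncurry (V n) z)) := by
      rw [integral_congr_ae (Eventually.of_forall (pwR n))]
      have iS : Integrable (fun z => (∑ i, (wg z (innerSmulBilin (b i) (uncurry (V n) z)
          (uncurry (N n i) z)) + wφ z * βb i (F n z) (C n i z))) +
          wφ z * βI (βev (F n z) (uncurry (V n) z)) (uncurry (V n) z)) (volume.restrict S) :=
        (integrable_finsetSum _ fun i _ => ((iT2a n i).add (iCOMM n i)).integrableOn).add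
          (iDL n).integrableOn
      have i1 : Integrable (fun z => wΔ z * βI (uncurry (V n) z) (uncurry (V n) z))
          (volume.restrict S) := (iT1 n).integrableOn
      have i2 : Integrable (fun z => 2 * ((∑ i, (wg z (innerSmulBilin (b i) (uncurry (V n) z)
          (uncurry (N n i) z)) + wφ z * βb i (F n z) (C n i z))) +
          wφ z * βI (βev (F n z) (uncurry (V n) z)) (uncurry (V n) z))) (volume.restrict S) :=
        iS.const_mul 2
      have i3 : Integrable (fun z => 2 * wg z (βs (uncurry (Pm n) z) (uncurry (V n) z)))
          (volume.restrict S) := (iT3 n).integrableOn.const_mul 2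
      have i12 : Integrable (fun z => wΔ z * βI (uncurry (V n) z) (uncurry (V n) z) +
          2 * ((∑ i, (wg z (innerSmulBilin (b i) (uncurry (V n) z) (uncurry (N n i) z)) +
            wφ z * βb i (F n z) (C n i z))) +
            wφ z * βI (βev (F n z) (uncurry (V n) z)) (uncurry (V n) z))) (volume.restrict S) :=
        i1.add i2
      have iTi : ∀ i ∈ Finset.univ, Integrable (fun z => wg z (innerSmulBilin (b i) (uncurry (V n) z)
          (uncurry (N n i) z)) + wφ z * βb i (F n z) (C n i z))
          (volume.restrict S) := fun i _ => ((iT2a n i).add (iCOMM n i)).integrableOn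
      have hsum : (∑ i, ∫ z in S, (wg z (innerSmulBilin (b i) (uncurry (V n) z)
          (uncurry (N n i) z)) + wφ z * βb i (F n z) (C n i z))) =
          (∑ i, ∫ z in S, wg z (innerSmulBilin (b i) (uncurry (V n) z) (uncurry (N n i) z))) +
            ∑ i, ∫ z in S, wφ z * βb i (F n z) (C n i z) := by
        rw [← Finset.sum_add_distrib]
        refine Finset.sum_congr rfl fun i _ => ?_
        exact integral_add (iT2a n i).integrableOn (iCOMM n i).integrableOn
      rw [integral_add i12 i3, integral_add i1 i2, integral_const_mul, integral_const_mul,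
        integral_add (integrable_finsetSum _ iTi) (iDL n).integrableOn,
        integral_finsetSum _ iTi, hsum]
    rw [eL2, eR] at h
    linarith [h, hdT]
  -- ### the limit identity
  have hev : ∀ᶠ n in atTop, (bump n).rOut ≤ δ :=
    ((tendsto_order.1 hbr).2 δ hδ).mono fun n hn => hn.le
  have I1 : 2 * ν * ∑ i, ∫ z in S, wφ z * βF i (Gt z) (Gt z) =
      (∫ z in S, wΔ z * βI (ũ z) (ũ z)) +
      2 * ((∑ i, ∫ z in S, wg z (innerSmulBilin (b i) (ũ z) (Nt i z))) +
        ∑ i : Fin (finrank ℝ E), (0 : ℝ)) -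
      (∫ z in S, wg z (βs (βI (ũ z) (ũ z)) (ũ z))) +
      2 * ∫ z in S, wg z (βs (pt z) (ũ z)) := by
    refine tendsto_nhds_unique_of_eventuallyEq
      ((tendsto_finsetSum _ fun i _ => limL2 i).const_mul _)
      (((limT1.add (((tendsto_finsetSum _ fun i _ => limT2a i).add
        (tendsto_finsetSum _ fun i _ => limCOMM i)).const_mul _)).sub limDR).add
        (limT3.const_mul _))
      (hev.mono fun n hn => hIDT n hn)
  simp only [Finset.sum_const_zero, add_zero] at I1
  -- ### (e) identification of the limits
  have hũu : ∀ z ∈ Kφ, ũ z = u z.1 z.2 := fun z hz => zeroExt_of_mem _ (hKΩ (hφK hz))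
  have hptp : ∀ z ∈ Kφ, pt z = p z.1 z.2 := fun z hz => zeroExt_of_mem _ (hKΩ (hφK hz))
  -- cL2
  have iL2inf : ∀ i, Integrable (fun z => wφ z * βF i (Gt z) (Gt z)) (volume : Measure (ℝ × E)) :=
    fun i => integrable_mul_bilin_of_memLp (p := 2) (q := 2) _ hGt hGt mwφ bwφ
  have pwL2inf : ∀ z : ℝ × E, (∑ i, wφ z * βF i (Gt z) (Gt z)) = φ z.1 z.2 * frobeniusNormSq (Gt z) :=
    fun z => by
    rw [frobeniusNormSq_eq_sum b, Finset.mul_sum]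
    refine Finset.sum_congr rfl fun i _ => ?_
    rw [βF_apply, real_inner_self_eq_norm_sq]
  have cL2 : ∑ i, ∫ z in S, wφ z * βF i (Gt z) (Gt z) =
      ∫ z in S, φ z.1 z.2 * frobeniusNormSq (Gt z) := by
    rw [← integral_finsetSum _ fun i _ => (iL2inf i).integrableOn]
    exact integral_congr_ae (Eventually.of_forall pwL2inf)
  -- cT1
  have pwT1 : ∀ z : ℝ × E, wΔ z * βI (ũ z) (ũ z) =
      ‖u z.1 z.2‖ ^ 2 * (timeDeriv φ z.1 z.2 + ν * (Δ (φ z.1)) z.2) := fun z => by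
    by_cases hz : z ∈ Kφ
    · rw [βI_apply, real_inner_self_eq_norm_sq, hũu z hz, mul_comm]
      simp only [hwΔ, add_comm]
    · obtain ⟨-, -, h3⟩ := hw0 z hz
      obtain ⟨-, -, h3', h4'⟩ := weights_eq_zero_of_notMem_tsupport hz
      rw [h3, h3', h4']; simp
  -- cDR
  have pwDRinf : ∀ z : ℝ × E, wg z (βs (βI (ũ z) (ũ z)) (ũ z)) =
      ‖u z.1 z.2‖ ^ 2 * ⟪u z.1 z.2, gradient (φ z.1) z.2⟫ := fun z => by
    by_cases hz : z ∈ Kφ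
    · rw [wg_apply, βs_apply, βI_apply, real_inner_smul_right, real_inner_self_eq_norm_sq, hũu z hz,
        real_inner_comm]
    · obtain ⟨-, h2, -⟩ := hw0 z hz
      obtain ⟨-, h2', -, -⟩ := weights_eq_zero_of_notMem_tsupport hz
      rw [h2, h2']; simp
  -- cT3
  have pwT3 : ∀ z : ℝ × E, wg z (βs (pt z) (ũ z)) = p z.1 z.2 * ⟪u z.1 z.2, gradient (φ z.1) z.2⟫ :=
    fun z => by
    by_cases hz : z ∈ Kφ
    · rw [wg_apply, βs_apply, real_inner_smul_right, hũu z hz, hptp z hz, real_inner_comm]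
    · obtain ⟨-, h2, -⟩ := hw0 z hz
      obtain ⟨-, h2', -, -⟩ := weights_eq_zero_of_notMem_tsupport hz
      rw [h2, h2']; simp
  -- I4: `Σᵢ T2a∞(i) = DR∞`
  have iT2ainf : ∀ i, Integrable (fun z => wg z (innerSmulBilin (b i) (ũ z) (Nt i z)))
      (volume : Measure (ℝ × E)) := fun i =>
    integrable_clm_bilin_of_memLp (p := 2) (q := 2) _ hũ2 (hNt2 i) mwg bwg
  have I4 : ∑ i, ∫ z in S, wg z (innerSmulBilin (b i) (ũ z) (Nt i z)) =
      ∫ z in S, wg z (βs (βI (ũ z) (ũ z)) (ũ z)) := by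
    rw [← integral_finsetSum _ fun i _ => (iT2ainf i).integrableOn]
    refine integral_congr_ae (Eventually.of_forall fun z => ?_)
    show (∑ i, wg z (innerSmulBilin (b i) (ũ z) (Nt i z))) = wg z (βs (βI (ũ z) (ũ z)) (ũ z))
    have e : ∀ i, innerSmulBilin (b i) (ũ z) (Nt i z) = (⟪ũ z, b i⟫ ^ 2) • ũ z := fun i => by
      rw [innerSmulBilin_apply, hNt' i]
      simp only
      rw [smul_smul, sq]
    have e2 : βs (βI (ũ z) (ũ z)) (ũ z) = (∑ i, ⟪ũ z, b i⟫ ^ 2) • ũ z := by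
      rw [βs_apply, βI_apply, real_inner_self_eq_norm_sq, b.sum_sq_inner_left]
    simp_rw [e]
    rw [← map_sum, ← Finset.sum_smul, e2]
  -- the limit identity in explicit form
  have iAinf : Integrable (fun z => wΔ z * βI (ũ z) (ũ z)) (volume : Measure (ℝ × E)) :=
    integrable_mul_bilin_of_memLp (p := 2) (q := 2) _ hũ2 hũ2 mwΔ bwΔ
  have iDRinf : Integrable (fun z => wg z (βs (βI (ũ z) (ũ z)) (ũ z))) (volume : Measure (ℝ × E)) :=
    integrable_clm_bilin_of_memLp (p := 3 / 2) (q := 3) _ msq0 hũ3 mwg bwg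
  have iT3inf : Integrable (fun z => wg z (βs (pt z) (ũ z))) (volume : Measure (ℝ × E)) :=
    integrable_clm_bilin_of_memLp (p := 3 / 2) (q := 3) _ hpt32 hũ3 mwg bwg
  rw [cL2, I4] at I1
  -- `I1 : 2ν ∫_S φ |G̃|² = T1∞ + 2 DR∞ - DR∞ + 2 T3∞`
  have I2 : 2 * ν * (∫ z in S, φ z.1 z.2 * frobeniusNormSq (Gt z)) =
      ∫ z in S, (wΔ z * βI (ũ z) (ũ z) + wg z (βs (βI (ũ z) (ũ z)) (ũ z)) +
        2 * wg z (βs (pt z) (ũ z))) := by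
    have i12 : Integrable (fun z => wΔ z * βI (ũ z) (ũ z) + wg z (βs (βI (ũ z) (ũ z)) (ũ z)))
        (volume.restrict S) := iAinf.integrableOn.add iDRinf.integrableOn
    have i3 : Integrable (fun z => 2 * wg z (βs (pt z) (ũ z))) (volume.restrict S) :=
      iT3inf.integrableOn.const_mul 2
    have i1 : Integrable (fun z => wΔ z * βI (ũ z) (ũ z)) (volume.restrict S) := iAinf.integrableOn
    have i2 : Integrable (fun z => wg z (βs (βI (ũ z) (ũ z)) (ũ z))) (volume.restrict S) :=
      iDRinf.integrableOn
    rw [integral_add i12 i3, integral_add i1 i2, integral_const_mul]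
    linarith [I1]
  -- ### (f) back to iterated whole-space integrals
  -- left-hand side
  have hL0 : ∀ z : ℝ × E, z ∉ S → φ z.1 z.2 * frobeniusNormSq (Gt z) = 0 := fun z hz => by
    rw [show φ z.1 z.2 = wφ z from rfl, (hw0 z (hφS z hz)).1, zero_mul]
  have iLHS : Integrable (fun z : ℝ × E => φ z.1 z.2 * frobeniusNormSq (Gt z))
      ((volume : Measure ℝ).prod (volume : Measure E)) := by
    rw [← Measure.volume_eq_prod]
    have h := integrable_finsetSum (Finset.univ : Finset (Fin (finrank ℝ E))) fun i _ => iL2inf i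
    exact h.congr (Eventually.of_forall fun z => pwL2inf z)
  have eLHS : (∫ z in S, φ z.1 z.2 * frobeniusNormSq (Gt z)) =
      ∫ t, ∫ x, frobeniusNormSq (Gt (t, x)) * φ t x := by
    rw [setIntegral_eq_integral_of_forall_compl_eq_zero hL0, Measure.volume_eq_prod,
      integral_prod _ iLHS]
    refine integral_congr_ae (Eventually.of_forall fun s => integral_congr_ae
      (Eventually.of_forall fun y => ?_))
    exact mul_comm _ _
  -- right-hand side
  set R : ℝ × E → ℝ := fun z => ‖u z.1 z.2‖ ^ 2 * (timeDeriv φ z.1 z.2 + ν * (Δ (φ z.1)) z.2) +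
    (‖u z.1 z.2‖ ^ 2 + 2 * p z.1 z.2) * ⟪u z.1 z.2, gradient (φ z.1) z.2⟫ with hR
  have pwRHS : ∀ z : ℝ × E, wΔ z * βI (ũ z) (ũ z) + wg z (βs (βI (ũ z) (ũ z)) (ũ z)) +
      2 * wg z (βs (pt z) (ũ z)) = R z := fun z => by
    rw [pwT1 z, pwDRinf z, pwT3 z, hR]
    ring
  have hR0 : ∀ z : ℝ × E, z ∉ S → R z = 0 := fun z hz => by
    rw [← pwRHS z]
    obtain ⟨h1, h2, h3⟩ := hw0 z (hφS z hz)
    rw [h2, h3]; simp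
  have iRHS : Integrable R ((volume : Measure ℝ).prod (volume : Measure E)) := by
    rw [← Measure.volume_eq_prod]
    exact ((iAinf.add iDRinf).add (iT3inf.const_mul 2)).congr (Eventually.of_forall fun z => by
      simp only [Pi.add_apply]
      exact pwRHS z)
  have eRHS : (∫ z in S, (wΔ z * βI (ũ z) (ũ z) + wg z (βs (βI (ũ z) (ũ z)) (ũ z)) +
      2 * wg z (βs (pt z) (ũ z)))) =
      ∫ t, ∫ x, (‖u t x‖ ^ 2 * (timeDeriv φ t x + ν * Δ (φ t) x) +
        (‖u t x‖ ^ 2 + 2 * p t x) * ⟪u t x, gradient (φ t) x⟫) := by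
    rw [integral_congr_ae (Eventually.of_forall pwRHS),
      setIntegral_eq_integral_of_forall_compl_eq_zero hR0, Measure.volume_eq_prod,
      integral_prod _ iRHS]
  rw [← eLHS, ← eRHS]
  exact I2

end Energy

/-! ### Bounded distributional solutions are suitable weak solutions -/

section Assembly

variable {E : Type*} [NormedAddCommGroup E] [InnerProductSpace ℝ E] [FiniteDimensional ℝ E]
  [MeasurableSpace E] [BorelSpace E]

omit [MeasurableSpace E] [BorelSpace E] in
/-- The Frobenius norm is dominated by the operator norm: `|L|²_F ≤ (dim E) ‖L‖²`. [folklore] -/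
theorem frobeniusNormSq_le_finrank_mul_sq_norm (L : E →L[ℝ] E) :
    frobeniusNormSq L ≤ (finrank ℝ E : ℝ) * ‖L‖ ^ 2 := by
  set b := stdOrthonormalBasis ℝ E
  rw [frobeniusNormSq_eq_sum b]
  calc ∑ i, ‖L (b i)‖ ^ 2 ≤ ∑ _i : Fin (finrank ℝ E), ‖L‖ ^ 2 := by
        refine Finset.sum_le_sum fun i _ => ?_
        have h : ‖L (b i)‖ ≤ ‖L‖ := by
          calc ‖L (b i)‖ ≤ ‖L‖ * ‖b i‖ := L.le_opNorm _
            _ = ‖L‖ := by rw [b.orthonormal.1 i, mul_one]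
        exact pow_le_pow_left₀ (norm_nonneg _) h 2
    _ = (finrank ℝ E : ℝ) * ‖L‖ ^ 2 := by
        rw [Finset.sum_const, Finset.card_univ, Fintype.card_fin, nsmul_eq_mul]

omit [BorelSpace E] in
/-- An `L²` operator field has locally (indeed globally) integrable squared Frobenius norm. [folklore] -/
theorem lintegral_frobeniusNormSq_lt_top_of_memLp {μ : Measure (ℝ × E)} {G : ℝ × E → E →L[ℝ] E}
    (hG : MemLp G 2 μ) : ∫⁻ z, ENNReal.ofReal (frobeniusNormSq (G z)) ∂μ < ∞ := by
  have h1 : ∀ z, ENNReal.ofReal (frobeniusNormSq (G z)) ≤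
      ENNReal.ofReal (finrank ℝ E : ℝ) * ‖G z‖ₑ ^ 2 := fun z => by
    rw [← ofReal_norm, ← ENNReal.ofReal_pow (norm_nonneg _), ← ENNReal.ofReal_mul (by positivity)]
    exact ENNReal.ofReal_le_ofReal (frobeniusNormSq_le_finrank_mul_sq_norm _)
  calc ∫⁻ z, ENNReal.ofReal (frobeniusNormSq (G z)) ∂μ
      ≤ ∫⁻ z, ENNReal.ofReal (finrank ℝ E : ℝ) * ‖G z‖ₑ ^ 2 ∂μ := lintegral_mono h1
    _ = ENNReal.ofReal (finrank ℝ E : ℝ) * ∫⁻ z, ‖G z‖ₑ ^ 2 ∂μ := by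
        rw [lintegral_const_mul' _ _ ENNReal.ofReal_ne_top]
    _ < ∞ := by
        refine ENNReal.mul_lt_top ENNReal.ofReal_lt_top ?_
        rw [← MollifiedLimits.eLpNorm_two_pow_two]
        exact ENNReal.pow_lt_top hG.eLpNorm_lt_top

/-- **Bounded distributional solutions are suitable on relatively compact subregions.** Let
`(u, p)` solve the unforced Navier–Stokes system (viscosity `ν > 0`) in the sense of
distributions on an open `Ω ⊆ ℝ × E` of finite measure, with `‖u‖ ≤ M` a.e. on `Ω` and
`p ∈ L^{3/2}(Ω)`. Then `(u, p)` is a suitable weak solution (accepted `IsSuitableWeakSolutionOn`;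
Caffarelli–Kohn–Nirenberg 1982, (2.1)–(2.5)) on every open `Ω'` contained in a compact subset
`K` of `Ω`: the energy class from the bound, the pressure class by hypothesis, the weak gradient
and the local energy inequality (with equality) from `exists_L2_limit_mollifiedGradient`,
`hasWeakSpatialGradientOn_of_L2_limit` and `localEnergyIdentity_of_L2_limit` (Seregin–Šverák
2009, §2 p. 6 and Remark 3.4; Serrin 1962, §2). [cite: SereginSverak2009, §2 p. 6 and Remark 3.4] -/
theorem isSuitableWeakSolutionOn_of_bounded_of_subset {ν : ℝ} (hν : 0 < ν)
    {Ω : Opens (ℝ × E)} {u : ℝ → E → E} {p : ℝ → E → ℝ}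
    (hNS : IsDistributionalNSSolutionOn Ω ν 0 u p)
    (hΩ : volume (Ω : Set (ℝ × E)) < ∞)
    {M : ℝ} (hM : ∀ᵐ z ∂(volume.restrict (Ω : Set (ℝ × E))), ‖u z.1 z.2‖ ≤ M)
    (hp : ∫⁻ z in (Ω : Set (ℝ × E)), ‖p z.1 z.2‖ₑ ^ (3 / 2 : ℝ) < ∞)
    {K : Set (ℝ × E)} (hK : IsCompact K) (hKΩ : K ⊆ (Ω : Set (ℝ × E)))
    {Ω' : Opens (ℝ × E)} (hΩ'K : (Ω' : Set (ℝ × E)) ⊆ K) :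
    IsSuitableWeakSolutionOn Ω' ν 0 u p := by
  haveI : (volume : Measure (ℝ × E)).IsAddHaarMeasure := Measure.prod.instIsAddHaarMeasure _ _
  have hQm : MeasurableSet (Ω : Set (ℝ × E)) := Ω.isOpen.measurableSet
  haveI : IsFiniteMeasure (volume.restrict (Ω : Set (ℝ × E))) :=
    ⟨by rwa [Measure.restrict_apply_univ]⟩
  have hΩ'Ω : Ω' ≤ Ω := fun z hz => hKΩ (hΩ'K hz)
  have hvm : AEStronglyMeasurable (uncurry u) (volume.restrict (Ω : Set (ℝ × E))) :=
    hNS.1.aestronglyMeasurable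
  have hu2Q : MemLp (uncurry u) 2 (volume.restrict (Ω : Set (ℝ × E))) :=
    (memLp_top_of_bound hvm M hM).mono_exponent le_top
  obtain ⟨bump, hbr, -⟩ := FunctionSpaces.exists_contDiffBump_seq (E := ℝ × E)
  obtain ⟨Gt, hGt, hconv⟩ := exists_L2_limit_mollifiedGradient hν hNS hΩ hM hp hbr hK hKΩ
  refine
    { distributional := IsDistributionalNSSolutionOn.mono_holds hNS hΩ'Ω
      energyClass := fun K' hK' hK'c => exists_energyClass_of_ae_bound hQm hM hK'c
        (hK'.trans hΩ'Ω)
      pressure := fun K' hK' hK'c => lt_of_le_of_lt (lintegral_mono_set (hK'.trans hΩ'Ω)) hp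
      localEnergy := ⟨fun t x => Gt (t, x),
        hasWeakSpatialGradientOn_of_L2_limit hΩ hNS.1 hu2Q hbr hK hKΩ hGt hconv hΩ'K,
        fun K' hK' hK'c => ?_, fun φ hφ _ => ?_⟩ }
  · exact lt_of_le_of_lt (setLIntegral_le_lintegral _ _) (lintegral_frobeniusNormSq_lt_top_of_memLp hGt)
  · have h := localEnergyIdentity_of_L2_limit hNS hΩ hM hp hbr hK hKΩ hGt hconv (hφ.mono hΩ'Ω)
      (hφ.tsupport_subset.trans hΩ'K)
    simp only [Pi.zero_apply, inner_zero_left, mul_zero, zero_mul, add_zero]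
    exact h.le

/-- **Bounded distributional solutions of the Navier–Stokes system are suitable weak
solutions.** Let `(u, p)` solve the unforced Navier–Stokes system (viscosity `ν > 0`) in the
sense of distributions on an open `Ω ⊆ ℝ × E` of finite measure, with `u` essentially bounded on
`Ω` and `p ∈ L^{3/2}(Ω)`. Then `(u, p)` is a suitable weak solution on `Ω` in the sense of
Caffarelli–Kohn–Nirenberg 1982 / Lin 1998 (accepted `IsSuitableWeakSolutionOn`): by
`isSuitableWeakSolutionOn_of_bounded_of_subset` on the members of an open exhaustion of `Ω`
(`exists_open_exhaustion`) and the gluing theorem `IsSuitableWeakSolutionOn.of_exhaustion`. This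
is the classical fact behind "it is certainly true in `B × ]-1,-a²[`" (Seregin–Šverák 2009, §2
p. 6 of arXiv:0804.1803; Serrin 1962). [cite: SereginSverak2009, §2 p. 6 and Remark 3.4] -/
theorem isSuitableWeakSolutionOn_of_bounded {ν : ℝ} (hν : 0 < ν)
    {Ω : Opens (ℝ × E)} {u : ℝ → E → E} {p : ℝ → E → ℝ}
    (hNS : IsDistributionalNSSolutionOn Ω ν 0 u p)
    (hΩ : volume (Ω : Set (ℝ × E)) < ∞)
    {M : ℝ} (hM : ∀ᵐ z ∂(volume.restrict (Ω : Set (ℝ × E))), ‖u z.1 z.2‖ ≤ M)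
    (hp : ∫⁻ z in (Ω : Set (ℝ × E)), ‖p z.1 z.2‖ₑ ^ (3 / 2 : ℝ) < ∞) :
    IsSuitableWeakSolutionOn Ω ν 0 u p := by
  obtain ⟨U, hmono, hcpt, hcov⟩ := exists_open_exhaustion Ω
  have hle : ∀ n, U n ≤ Ω := fun n => by
    obtain ⟨K, -, hUK, hKΩ⟩ := hcpt n
    exact fun z hz => hKΩ (hUK hz)
  refine IsSuitableWeakSolutionOn.of_exhaustion hle hmono hcov fun n => ?_
  obtain ⟨K, hK, hUK, hKΩ⟩ := hcpt n
  exact isSuitableWeakSolutionOn_of_bounded_of_subset hν hNS hΩ hM hp hK hKΩ hUK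

end Assembly

end Literature.Analysis.FluidPDE
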